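import Summits.QuantumFields.BalabanUV.T4Continuum.Support.AveragingDeficitBlockDensityFrame
import Summits.QuantumFields.BalabanUV.T4Continuum.Support.AveragingDeficitBlockDensitySeg
import HarnessLib

/-!
# AveragingDeficitBlockDensityPush (T⁴ programme, node NE3, row NE3-R2, gen 6) — THE LINEARISED AVERAGE OF THE BLOCK DENSITY:
# `pushDir L U (S₀φ) (L•y) κ − φ(y,κ) = ((L−1)/2L)·Ad_{V̄(c)⁻¹}[covFd V̄ φ y κ κ − Σ_j covFd V̄ φ y κ j] + O(a)·sup_{near c}‖φ‖`, hence
# **`‖(pushDir∘S₀ − Id)φ (c)‖ ≤ Σ_j ‖covFd (cavg L U) φ y κ j‖ + kPush(d,L)·a·s_c`**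
# (file 6 of (γ2), the gradient-bounded one-step lift — record `t4/T4-EST-NE3-R2.md` v0.6 §4)

HONEST FRAMING (cell `pub-balaban`, T4-DAG PAGE 1; unit `b2b-balaban-t4-ne3r2-p1` = owner of BINDER-OWNERS row NE3-R2, gen 6).
The cell's T4 target is the finite-torus continuum limit of the unit-scale averaged loop expectations — NOT infinite volume, NO
mass gap, NOT Clay, NOT summit progress.  WHY.  The lift of (γ2) is `S = S₀ − spreadInverse ∘ ψ`, `ψ := pushDir∘S₀ − Id` (the
`liftDefect`); its gradient bound needs `ψ` SMALL in the sense `‖ψ(c)‖ ≲ (coarse covariant differences of φ at c) + O(a)‖φ‖`.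
THIS FILE assembles it from leaf-10's split `pushDir = gaugeDir (cavg L U) (frameLin ∘ L•) + dbarLin`
(`BlockAveragePushDirSplit.pushDir_eq_gaugeDir_add_dbarLin`), the structure `dbarLin = Ad_{V̄(c)⁻¹} segMain + O(w)`
(`BlockAverageDbarLinBound.norm_dbarLin_sub_main_le`, BY NAME), this row's exact frames (file 4, `norm_gaugeDir_frameLin_add_le`) and
segments (file 5, `norm_segMain_blockDensity_sub_le`).  All [folklore], 0 sorry: §1 the local `ℓ¹` weights of `S₀φ` against a local
sup `s` of `φ` (`‖φ(⌊x/L⌋,μ)‖ ≤ s` for `|x − Ly|₁ ≤ nbRad`) and **`norm_dbarLin_blockDensity_sub_main_le`**: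
`‖dbarLin L U (S₀φ)(c) − Ad_{V̄(c)⁻¹} segMain‖ ≤ loopRad·(1250(2d+3) + 8d + 2)·s`; §2 the `e^{X_c}` swaps of the main segment term
(`norm_Ad_cavg_inv_main_sub_le`, `≤ 8·loopRad·(‖φ(y,κ)‖ + ‖φ(y+e_κ,κ)‖)`); §3 **`liftDefect`** `ψ(y,κ) := pushDir L U (S₀φ) (L•y) κ − φ(y,κ)`,
the identity `ψ − M = (frame part + …) + (dbarLin − Ad segMain) + Ad(segMain − main) + (swaps)` with
`M = ((L−1)/2L)·Ad_{V̄(c)⁻¹}[covFd V̄ φ y κ κ − Σ_j covFd V̄ φ y κ j]`, **`norm_liftDefect_sub_main_le`** (`≤ kPush·a·s`), `norm_main_le`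
(`≤ Σ_j ‖covFd V̄ φ y κ j‖`) and **`norm_liftDefect_le`**.  NE3 ITSELF IS NOT PROVED; nothing of Bałaban's is asserted (context:
[Balaban1985Averaging] (42) p. 23, (120)–(125) p. 36; [Balaban1985Variational] (75)–(77) p. 289).  ABSOLUTE RULE kept: no printed
sentence is a hypothesis.  PLACEMENT: `Summits/QuantumFields/BalabanUV/`; imports this row's `AveragingDeficitBlockDensityFrame` ∕ `…Seg`.
-/

set_option autoImplicit false

open scoped BigOperators Matrix Matrix.Norms.L2Operator
open NormedSpace Finset

namespace Summit.QuantumFields.BalabanUV.T4Continuum.AveragingDeficitBlockDensityPush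

open Literature.MathematicalPhysics.QuantumFieldTheory.Balaban1983to89
open B7Prop1Explicit B7Prop2Explicit MatrixLog UnitaryModel
open T4AveragingDeficitWall hiding Site Plane Plaq Bond
open T4AveragingDeficitNonAbelian (Ad_mul Ad_sub)
open AveragingDeficitTransport (dhol lnorm lnorm_nil lnorm_cons norm_Ad_of_unitary)
open AveragingDeficitNearIdentity (Ad_one norm_Ad_sub_le Ad_real_smul Ad_add Ad_sum)
open AveragingDeficitSideDeriv (loopWord)
open AveragingDeficitResidualPairing (pushDir)
open AveragingDeficitChartCalculus (cavg)
open AveragingDeficitCovGrad (covFd)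
open SpreadLift (loopRad loopRad_le loopBound_of_smallField)
open SkeletonLattice (cdiv cdiv_eq_of_repr)
open BlockAverageVaryHolo (nbRad length_loopWord_le l1_sub_self)
open BlockAveragePushDirGauge (gaugeDir)
open BlockAveragePushDirSplit (frameLin dbarLin pushDir_eq_gaugeDir_add_dbarLin)
open BlockAverageDbarLinBound (segMain loopL1 treeL1' norm_dbarLin_sub_main_le)
open BlockAverageDbarLinNorms (lnorm_le_length_mul_sup l1_natCast_smul_e)
open AveragingDeficitBlockDensity AveragingDeficitBlockDensityFrame AveragingDeficitBlockDensitySeg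

noncomputable section

variable {d : ℕ} {n : Type*} [Fintype n] [DecidableEq n]

/-- `‖A + B + C + D‖ ≤ ‖A‖ + ‖B‖ + ‖C‖ + ‖D‖`. [folklore] -/
theorem norm_add₄_le (A B C D : Matrix n n ℂ) :
    ‖A + B + C + D‖ ≤ ‖A‖ + ‖B‖ + ‖C‖ + ‖D‖ :=
  (norm_add_le _ _).trans (add_le_add ((norm_add_le _ _).trans (add_le_add (norm_add_le _ _) le_rfl)) le_rfl)

/-! ## §1 The `O(w)` error of `dbarLin` on the block density against a local sup of `φ` -/

section Small

variable [Nonempty n] {L : ℕ} (hL : 1 ≤ L) {U : Site d → Fin d → (Matrix n n ℂ)ˣ} (hU : IsUnitaryCfg U) {a : ℝ} (ha : 0 ≤ a)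
  (h512 : 512 * (d + 1) * (d + 4) * (L : ℝ) ^ 2 * a ≤ 1) (hUa : SmallField U a)

/-- THE CONSTANT of the `dbarLin` error against the local sup: `1250(2d+3) + 8d + 2`. [folklore] -/
def cDb (d : ℕ) : ℝ := 1250 * (2 * (d : ℝ) + 3) + 8 * d + 2

include hU in
omit [Nonempty n] in
/-- The block density is pointwise `≤ L⁻¹·s` near `c` when `‖φ(⌊x/L⌋, μ)‖ ≤ s` there. [folklore] -/
theorem norm_blockDensity_le_of_sup (φ : Site d → Fin d → Matrix n n ℂ) (y : Site d) {s : ℝ}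
    (hs : ∀ (x : Site d) (μ : Fin d), l1 (x - (L : ℤ) • y) ≤ nbRad d L → ‖φ (cdiv L x) μ‖ ≤ s) :
    ∀ (x : Site d) (μ : Fin d), l1 (x - (L : ℤ) • y) ≤ nbRad d L → ‖blockDensity L U φ x μ‖ ≤ (L : ℝ)⁻¹ * s :=
  fun x μ hx => by
    rw [norm_blockDensity hU]
    exact mul_le_mul_of_nonneg_left (hs x μ hx) (by positivity)

include hL hU ha h512 hUa in
/-- **THE `O(w)` ERROR OF `dbarLin` ON THE BLOCK DENSITY**: `‖dbarLin L U (S₀φ)(c) − Ad_{V̄(c)⁻¹} segMain L U (S₀φ)(c)‖ ≤ loopRad·cDb·s`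
(leaf-10's `norm_dbarLin_sub_main_le` BY NAME; the local `ℓ¹` weights of `S₀φ` are `≤ |word|·L⁻¹·s`). [folklore] -/
theorem norm_dbarLin_blockDensity_sub_main_le (φ : Site d → Fin d → Matrix n n ℂ) (y : Site d) (κ : Fin d) {s : ℝ}
    (hs : ∀ (x : Site d) (μ : Fin d), l1 (x - (L : ℤ) • y) ≤ nbRad d L → ‖φ (cdiv L x) μ‖ ≤ s) :
    ‖dbarLin L U (blockDensity L U φ) ((L : ℤ) • y) κ
        - Ad (cavg L U y κ)⁻¹ (segMain L U (blockDensity L U φ) ((L : ℤ) • y) κ)‖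
      ≤ loopRad d L a * cDb d * s := by
  set q : Site d := (L : ℤ) • y with hq
  set Y := blockDensity L U φ with hY
  have hw := loopRad_le (d := d) h512
  have hw0 : 0 ≤ loopRad d L a := by unfold SpreadLift.loopRad; positivity
  have hWcx : ∀ r : Fin d → Fin L, ‖((Wcx L U q κ (boxVec L r) : (Matrix n n ℂ)ˣ) : Matrix n n ℂ) - 1‖ ≤ loopRad d L a :=
    loopBound_of_smallField hL hU ha h512 hUa y κ
  have hYs := norm_blockDensity_le_of_sup (L := L) hU φ y hs
  have hs0 : 0 ≤ s := (norm_nonneg _).trans (hs q κ (by rw [hq, l1_sub_self]; exact Nat.zero_le _))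
  have ht0 : 0 ≤ (L : ℝ)⁻¹ * s := by positivity
  have hwt := BlockAveragePushDirSplit.sum_blockWeight_eq_one (d := d) L hL
  have hL0 : (L : ℝ) ≠ 0 := by exact_mod_cast (by omega : L ≠ 0)
  -- the local weights against `L⁻¹ s`
  have hseg0 : lnorm Y q (seg κ L) ≤ L * ((L : ℝ)⁻¹ * s) := by
    have h := lnorm_le_length_mul_sup Y hYs (seg κ (L : ℤ)) q (by rw [l1_sub_self, length_seg, Int.natAbs_natCast, nbRad]; omega)
    rwa [length_seg, Int.natAbs_natCast] at h
  have hloopL1 : loopL1 L Y q κ ≤ (nbRad d L : ℝ) * ((L : ℝ)⁻¹ * s) := by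
    unfold BlockAverageDbarLinBound.loopL1
    calc _ ≤ ∑ _r : Fin d → Fin L, ((L : ℝ) ^ d)⁻¹ * ((nbRad d L : ℝ) * ((L : ℝ)⁻¹ * s)) := by
          refine Finset.sum_le_sum fun r _ => mul_le_mul_of_nonneg_left ?_ (by positivity)
          have h := lnorm_le_length_mul_sup Y hYs (loopWord L κ (boxVec L r)) q (by
            rw [l1_sub_self, zero_add]; exact length_loopWord_le L κ r)
          exact h.trans (mul_le_mul_of_nonneg_right (by exact_mod_cast length_loopWord_le L κ r) ht0)
      _ = (nbRad d L : ℝ) * ((L : ℝ)⁻¹ * s) := by rw [← Finset.sum_mul, hwt, one_mul]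
  have htreeL1 : treeL1' L Y q κ ≤ (d * L : ℝ) * ((L : ℝ)⁻¹ * s) := by
    unfold BlockAverageDbarLinBound.treeL1'
    calc _ ≤ ∑ _r : Fin d → Fin L, ((L : ℝ) ^ d)⁻¹ * ((d * L : ℝ) * ((L : ℝ)⁻¹ * s)) := by
          refine Finset.sum_le_sum fun r _ => mul_le_mul_of_nonneg_left ?_ (by positivity)
          have hlen : (treeWord (boxVec L r)).length ≤ d * L := by rw [length_treeWord]; exact l1_boxVec_le L r
          have hl := l1_natCast_smul_e (d := d) L κ
          have h := lnorm_le_length_mul_sup Y hYs (treeWord (boxVec L r)) (q + (L : ℤ) • e κ) (by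
            rw [add_sub_cancel_left, hl, length_treeWord, nbRad]; have := l1_boxVec_le L r; omega)
          exact h.trans (mul_le_mul_of_nonneg_right (by exact_mod_cast hlen) ht0)
      _ = (d * L : ℝ) * ((L : ℝ)⁻¹ * s) := by rw [← Finset.sum_mul, hwt, one_mul]
  have h := norm_dbarLin_sub_main_le L hL hU Y q κ hw hWcx
  refine h.trans ?_
  have hnb : (nbRad d L : ℝ) = (2 * d + 2) * L := by simp only [nbRad]; push_cast; ring
  rw [hnb] at hloopL1
  have e1 : loopRad d L a * cDb d * s
      = loopRad d L a * (1250 * ((2 * d + 2) * L * ((L : ℝ)⁻¹ * s) + L * ((L : ℝ)⁻¹ * s))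
          + 8 * ((d * L : ℝ) * ((L : ℝ)⁻¹ * s)) + 2 * (L * ((L : ℝ)⁻¹ * s))) := by
    unfold cDb; field_simp; ring
  rw [e1]
  have h1250 : (0 : ℝ) ≤ 1250 := by norm_num
  gcongr

/-! ## §2 The `e^{X_c}` swaps of the main segment term -/

include hL hU ha h512 hUa in
/-- `‖Ad_{V̄(c)⁻¹}[((L+1)/2L)·Ad_{U(Γ_c)}φ_κ + ((L−1)/2L)·Ad_{U(Γ_c)U(Γ_{c′})}φ′_κ] − [((L+1)/2L)·φ_κ + ((L−1)/2L)·Ad_{V̄(c′)}φ′_κ]‖ ≤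
8·loopRad·(‖φ_κ‖ + ‖φ′_κ‖)`. [folklore] -/
theorem norm_Ad_cavg_inv_main_sub_le (φ : Site d → Fin d → Matrix n n ℂ) (y : Site d) (κ : Fin d) :
    ‖Ad (cavg L U y κ)⁻¹ ((((L : ℝ) + 1) / (2 * L)) • Ad (bseg L U y κ) (φ y κ)
          + (((L : ℝ) - 1) / (2 * L)) • Ad (bseg L U y κ * bseg L U (y + e κ) κ) (φ (y + e κ) κ))
        - ((((L : ℝ) + 1) / (2 * L)) • φ y κ + (((L : ℝ) - 1) / (2 * L)) • Ad (cavg L U (y + e κ) κ) (φ (y + e κ) κ))‖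
      ≤ 8 * loopRad d L a * (‖φ y κ‖ + ‖φ (y + e κ) κ‖) := by
  have hUc : ∀ z μ, cavg L U z μ ∈ unitaryUnits (Matrix n n ℂ) := fun z μ => cavg_mem hL hU ha h512 hUa z μ
  have hlr0 : 0 ≤ loopRad d L a := by unfold SpreadLift.loopRad; positivity
  have hL1 : (1 : ℝ) ≤ L := by exact_mod_cast hL
  have hc1 : 0 ≤ ((L : ℝ) + 1) / (2 * L) := by positivity
  have hc1' : ((L : ℝ) + 1) / (2 * L) ≤ 1 := by rw [div_le_one (by positivity)]; linarith
  have hc2 : 0 ≤ ((L : ℝ) - 1) / (2 * L) := div_nonneg (by linarith) (by positivity)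
  have hc2' : ((L : ℝ) - 1) / (2 * L) ≤ 1 / 2 := by rw [div_le_div_iff₀ (by positivity) (by norm_num)]; linarith
  set E : (Matrix n n ℂ)ˣ := (cavg L U y κ)⁻¹ * bseg L U y κ with hE
  have hEu : E ∈ unitaryUnits (Matrix n n ℂ) := (unitaryUnits _).mul_mem ((unitaryUnits _).inv_mem (hUc y κ)) (bseg_mem hU L y κ)
  have hEn : ‖(E : Matrix n n ℂ) - 1‖ ≤ 4 * loopRad d L a := norm_cavg_inv_bseg_sub_one_le hL hU ha h512 hUa y κ
  -- rewrite as a combination of two differences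
  have e1 : Ad (cavg L U y κ)⁻¹ ((((L : ℝ) + 1) / (2 * L)) • Ad (bseg L U y κ) (φ y κ)
          + (((L : ℝ) - 1) / (2 * L)) • Ad (bseg L U y κ * bseg L U (y + e κ) κ) (φ (y + e κ) κ))
        - ((((L : ℝ) + 1) / (2 * L)) • φ y κ + (((L : ℝ) - 1) / (2 * L)) • Ad (cavg L U (y + e κ) κ) (φ (y + e κ) κ))
      = (((L : ℝ) + 1) / (2 * L)) • (Ad E (φ y κ) - φ y κ)
        + (((L : ℝ) - 1) / (2 * L)) • ((Ad E (Ad (bseg L U (y + e κ) κ) (φ (y + e κ) κ)) - Ad (bseg L U (y + e κ) κ) (φ (y + e κ) κ))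
            + (Ad (bseg L U (y + e κ) κ) (φ (y + e κ) κ) - Ad (cavg L U (y + e κ) κ) (φ (y + e κ) κ))) := by
    rw [hE, Ad_add, Ad_real_smul, Ad_real_smul, ← Ad_mul, ← Ad_mul, ← mul_assoc, Ad_mul ((cavg L U y κ)⁻¹ * bseg L U y κ),
      smul_sub, smul_add, smul_sub, smul_sub]
    abel
  rw [e1]
  have t1 : ‖Ad E (φ y κ) - φ y κ‖ ≤ 2 * (4 * loopRad d L a) * ‖φ y κ‖ :=
    (norm_Ad_sub_le hEu _).trans (by gcongr)
  have t2 : ‖Ad E (Ad (bseg L U (y + e κ) κ) (φ (y + e κ) κ)) - Ad (bseg L U (y + e κ) κ) (φ (y + e κ) κ)‖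
      ≤ 2 * (4 * loopRad d L a) * ‖φ (y + e κ) κ‖ := by
    refine (norm_Ad_sub_le hEu _).trans ?_
    rw [norm_Ad_of_unitary (bseg_mem hU L _ κ)]
    gcongr
  have t3 : ‖Ad (bseg L U (y + e κ) κ) (φ (y + e κ) κ) - Ad (cavg L U (y + e κ) κ) (φ (y + e κ) κ)‖
      ≤ 2 * (4 * loopRad d L a) * ‖φ (y + e κ) κ‖ :=
    norm_Ad_sub_Ad_le_of_le (bseg_mem hU L _ κ) (hUc _ κ) _ (norm_cavg_inv_bseg_sub_one_le hL hU ha h512 hUa _ κ)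
  calc _ ≤ ‖(((L : ℝ) + 1) / (2 * L)) • (Ad E (φ y κ) - φ y κ)‖
        + ‖(((L : ℝ) - 1) / (2 * L)) • ((Ad E (Ad (bseg L U (y + e κ) κ) (φ (y + e κ) κ)) - Ad (bseg L U (y + e κ) κ) (φ (y + e κ) κ))
            + (Ad (bseg L U (y + e κ) κ) (φ (y + e κ) κ) - Ad (cavg L U (y + e κ) κ) (φ (y + e κ) κ)))‖ := norm_add_le _ _
    _ ≤ 1 * (2 * (4 * loopRad d L a) * ‖φ y κ‖)
        + (1 / 2) * (2 * (4 * loopRad d L a) * ‖φ (y + e κ) κ‖ + 2 * (4 * loopRad d L a) * ‖φ (y + e κ) κ‖) := by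
        rw [norm_smul, norm_smul, Real.norm_of_nonneg hc1, Real.norm_of_nonneg hc2]
        exact add_le_add (mul_le_mul hc1' t1 (norm_nonneg _) zero_le_one)
          (mul_le_mul hc2' ((norm_add_le _ _).trans (add_le_add t2 t3)) (norm_nonneg _) (by norm_num))
    _ = 8 * loopRad d L a * (‖φ y κ‖ + ‖φ (y + e κ) κ‖) := by ring

/-! ## §3 The lift defect `ψ = pushDir ∘ S₀ − Id` and its bound -/

/-- **THE LIFT DEFECT** `ψ(y, κ) := pushDir L U (S₀φ) (Ly, κ) − φ(y, κ)` — what the exact inverse has to correct. [folklore] -/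
def liftDefect (L : ℕ) (U : Site d → Fin d → (Matrix n n ℂ)ˣ) (φ : Site d → Fin d → Matrix n n ℂ) :
    Site d → Fin d → Matrix n n ℂ :=
  fun y κ => pushDir L U (blockDensity L U φ) ((L : ℤ) • y) κ - φ y κ

/-- THE MAIN TERM of the lift defect: `((L−1)/2L)·Ad_{V̄(c)⁻¹}[covFd V̄ φ y κ κ − Σ_j covFd V̄ φ y κ j]`. [folklore] -/
def liftMain (L : ℕ) (U : Site d → Fin d → (Matrix n n ℂ)ˣ) (φ : Site d → Fin d → Matrix n n ℂ) (y : Site d) (κ : Fin d) :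
    Matrix n n ℂ :=
  (((L : ℝ) - 1) / (2 * L)) • Ad (cavg L U y κ)⁻¹ (covFd (cavg L U) φ y κ κ - ∑ j : Fin d, covFd (cavg L U) φ y κ j)

/-- THE CONSTANT of the `O(a)` part of the lift defect. [folklore] -/
def kPush (d L : ℕ) : ℝ :=
  16 * ((d : ℝ) + 1) * ((d : ℝ) + 4) * (L : ℝ) ^ 2 * (8 * d + 16 + cDb d)
    + 4 * ((2 * (d : ℝ) + 1) * L) ^ 2 + 2 * (2 * ((d : ℝ) + 1) * L) ^ 2

include hL in
omit [Nonempty n] in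
/-- The algebra of the assembly: `ψ − M` as the sum of the four controlled differences. [folklore] -/
theorem liftDefect_sub_main_eq (φ : Site d → Fin d → Matrix n n ℂ) (y : Site d) (κ : Fin d) :
    liftDefect L U φ y κ - liftMain L U φ y κ
      = (gaugeDir (cavg L U) (fun z => frameLin L U (blockDensity L U φ) ((L : ℤ) • z)) y κ
            + (((L : ℝ) - 1) / (2 * L)) • Ad (cavg L U y κ)⁻¹ (∑ j : Fin d, covFd (cavg L U) φ y κ j))
        + (dbarLin L U (blockDensity L U φ) ((L : ℤ) • y) κ
            - Ad (cavg L U y κ)⁻¹ (segMain L U (blockDensity L U φ) ((L : ℤ) • y) κ))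
        + Ad (cavg L U y κ)⁻¹ (segMain L U (blockDensity L U φ) ((L : ℤ) • y) κ
            - ((((L : ℝ) + 1) / (2 * L)) • Ad (bseg L U y κ) (φ y κ)
                + (((L : ℝ) - 1) / (2 * L)) • Ad (bseg L U y κ * bseg L U (y + e κ) κ) (φ (y + e κ) κ)))
        + (Ad (cavg L U y κ)⁻¹ ((((L : ℝ) + 1) / (2 * L)) • Ad (bseg L U y κ) (φ y κ)
              + (((L : ℝ) - 1) / (2 * L)) • Ad (bseg L U y κ * bseg L U (y + e κ) κ) (φ (y + e κ) κ))
            - ((((L : ℝ) + 1) / (2 * L)) • φ y κ + (((L : ℝ) - 1) / (2 * L)) • Ad (cavg L U (y + e κ) κ) (φ (y + e κ) κ))) := by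
  have hsplit := pushDir_eq_gaugeDir_add_dbarLin L U (blockDensity L U φ) y κ
  -- the own-bond covariant difference: `Ad_{V̄(c)⁻¹} covFd V̄ φ y κ κ = Ad_{V̄(c′)} φ′_κ − φ_κ`
  have hown : Ad (cavg L U y κ)⁻¹ (covFd (cavg L U) φ y κ κ) = Ad (cavg L U (y + e κ) κ) (φ (y + e κ) κ) - φ y κ := by
    rw [covFd, Ad_sub, ← Ad_mul, ← Ad_mul, inv_mul_cancel_left, inv_mul_cancel, Ad_one]
  have hL0 : (L : ℝ) ≠ 0 := by exact_mod_cast (by omega : L ≠ 0)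
  have hc : ((L : ℝ) + 1) / (2 * L) = 1 - ((L : ℝ) - 1) / (2 * L) := by field_simp; ring
  have hbavg : bavg L U ((L : ℤ) • y) κ = cavg L U y κ := rfl
  rw [liftDefect, liftMain, hsplit, Ad_sub _ (covFd (cavg L U) φ y κ κ), hown]
  simp only [smul_sub, Ad_sub, hc, sub_smul, one_smul]
  abel

include hL hU ha h512 hUa in
/-- **THE LIFT DEFECT IS ITS MAIN TERM UP TO `kPush·a·s`**: for every local sup `s` of `φ` around `c`
(`‖φ(⌊x/L⌋, μ)‖ ≤ s` whenever `|x − Ly|₁ ≤ nbRad d L`), `‖ψ(y,κ) − M(y,κ)‖ ≤ kPush(d,L)·a·s`. [folklore] -/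
theorem norm_liftDefect_sub_main_le (φ : Site d → Fin d → Matrix n n ℂ) (y : Site d) (κ : Fin d) {s : ℝ}
    (hs : ∀ (x : Site d) (μ : Fin d), l1 (x - (L : ℤ) • y) ≤ nbRad d L → ‖φ (cdiv L x) μ‖ ≤ s) :
    ‖liftDefect L U φ y κ - liftMain L U φ y κ‖ ≤ kPush d L * a * s := by
  have hUc : ∀ z μ, cavg L U z μ ∈ unitaryUnits (Matrix n n ℂ) := fun z μ => cavg_mem hL hU ha h512 hUa z μ
  have hlr0 : 0 ≤ loopRad d L a := by unfold SpreadLift.loopRad; positivity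
  -- the values of `φ` on the two blocks are `≤ s`
  have hLpos : ∀ i : Fin d, (0 : Site d) i < (L : ℤ) := fun _ => by
    simp only [Pi.zero_apply]; exact_mod_cast (by omega : 0 < L)
  have hcd0 : cdiv L ((L : ℤ) • y) = y :=
    cdiv_eq_of_repr (L := L) (q := 0) (by simp) (fun _ => le_rfl) hLpos
  have hcd1 : cdiv L ((L : ℤ) • y + (L : ℤ) • e κ) = y + e κ :=
    cdiv_eq_of_repr (L := L) (x := (L : ℤ) • y + (L : ℤ) • e κ) (z := y + e κ) (q := 0)
      (by rw [smul_add, add_zero]) (fun _ => le_rfl) hLpos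
  have hsy : ∀ j, ‖φ y j‖ ≤ s := fun j => by
    have h := hs ((L : ℤ) • y) j (by rw [l1_sub_self]; exact Nat.zero_le _)
    rwa [hcd0] at h
  have hsy' : ∀ j, ‖φ (y + e κ) j‖ ≤ s := fun j => by
    have h := hs ((L : ℤ) • y + (L : ℤ) • e κ) j (by rw [add_sub_cancel_left, l1_natCast_smul_e, nbRad]; omega)
    rwa [hcd1] at h
  have hs0 : 0 ≤ s := (norm_nonneg _).trans (hsy κ)
  -- the four pieces
  have p1 := norm_gaugeDir_frameLin_add_le hL hU ha h512 hUa φ y κ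
  have p2 := norm_dbarLin_blockDensity_sub_main_le hL hU ha h512 hUa φ y κ hs
  have p3 := norm_segMain_blockDensity_sub_le hL hU ha hUa φ y κ
  have p4 := norm_Ad_cavg_inv_main_sub_le hL hU ha h512 hUa φ y κ
  have hsum : ∑ j : Fin d, (‖φ y j‖ + ‖φ (y + e κ) j‖) ≤ 2 * d * s := by
    calc ∑ j : Fin d, (‖φ y j‖ + ‖φ (y + e κ) j‖) ≤ ∑ _j : Fin d, (s + s) :=
          Finset.sum_le_sum fun j _ => add_le_add (hsy j) (hsy' j)
      _ = 2 * d * s := by rw [Finset.sum_const, Finset.card_univ, Fintype.card_fin, nsmul_eq_mul]; ring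
  rw [liftDefect_sub_main_eq hL φ y κ]
  refine (norm_add₄_le _ _ _ _).trans ?_
  rw [norm_Ad_of_unitary ((unitaryUnits _).inv_mem (hUc y κ))]
  -- collect: everything is `≤ (…)·a·s`
  have hlr : loopRad d L a = 16 * ((d : ℝ) + 1) * ((d : ℝ) + 4) * (L : ℝ) ^ 2 * a := by unfold SpreadLift.loopRad; ring
  have hφκ := hsy κ
  have hφκ' := hsy' κ
  have ha2 : 0 ≤ ((2 * d + 1) * L : ℝ) ^ 2 * a := by positivity
  have ha3 : 0 ≤ (2 * (d + 1) * L : ℝ) ^ 2 * a := by positivity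
  have p1' := p1.trans (mul_le_mul_of_nonneg_left hsum (by positivity))
  have p3' : ‖segMain L U (blockDensity L U φ) ((L : ℤ) • y) κ
        - ((((L : ℝ) + 1) / (2 * L)) • Ad (bseg L U y κ) (φ y κ)
            + (((L : ℝ) - 1) / (2 * L)) • Ad (bseg L U y κ * bseg L U (y + e κ) κ) (φ (y + e κ) κ))‖
      ≤ 2 * (((2 * d + 1) * L : ℝ) ^ 2 * a) * s
        + (2 * (((2 * d + 1) * L : ℝ) ^ 2 * a) + 2 * ((2 * (d + 1) * L : ℝ) ^ 2 * a)) * s :=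
    p3.trans (by gcongr)
  have p4' := p4.trans (mul_le_mul_of_nonneg_left (add_le_add hφκ hφκ') (by positivity))
  have e : kPush d L * a * s
      = 4 * loopRad d L a * (2 * d * s) + loopRad d L a * cDb d * s
        + (2 * (((2 * d + 1) * L : ℝ) ^ 2 * a) * s + (2 * (((2 * d + 1) * L : ℝ) ^ 2 * a) + 2 * ((2 * (d + 1) * L : ℝ) ^ 2 * a)) * s)
        + 8 * loopRad d L a * (s + s) := by
    rw [kPush, hlr]; ring
  linarith [p1', p2, p3', p4', e]

include hL in
omit [Nonempty n] in
/-- **THE MAIN TERM IS BOUNDED BY THE COARSE COVARIANT DIFFERENCES AT `c`**: `‖M(y,κ)‖ ≤ Σ_j ‖covFd (cavg L U) φ y κ j‖`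
(`(L−1)/2L ≤ 1/2`, the `κκ` term is one of the summands). [folklore] -/
theorem norm_liftMain_le (hUc : ∀ z μ, cavg L U z μ ∈ unitaryUnits (Matrix n n ℂ)) (φ : Site d → Fin d → Matrix n n ℂ)
    (y : Site d) (κ : Fin d) :
    ‖liftMain L U φ y κ‖ ≤ ∑ j : Fin d, ‖covFd (cavg L U) φ y κ j‖ := by
  have hL1 : (1 : ℝ) ≤ L := by exact_mod_cast hL
  have hc2 : 0 ≤ ((L : ℝ) - 1) / (2 * L) := div_nonneg (by linarith) (by positivity)
  have hc2' : ((L : ℝ) - 1) / (2 * L) ≤ 1 / 2 := by rw [div_le_div_iff₀ (by positivity) (by norm_num)]; linarith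
  unfold liftMain
  rw [norm_smul, Real.norm_of_nonneg hc2, norm_Ad_of_unitary ((unitaryUnits _).inv_mem (hUc y κ))]
  have h1 : ‖covFd (cavg L U) φ y κ κ - ∑ j : Fin d, covFd (cavg L U) φ y κ j‖ ≤ 2 * ∑ j : Fin d, ‖covFd (cavg L U) φ y κ j‖ := by
    refine (norm_sub_le _ _).trans ?_
    have h2 := norm_sum_le (Finset.univ : Finset (Fin d)) (fun j => covFd (cavg L U) φ y κ j)
    have h3 : ‖covFd (cavg L U) φ y κ κ‖ ≤ ∑ j : Fin d, ‖covFd (cavg L U) φ y κ j‖ :=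
      Finset.single_le_sum (f := fun j => ‖covFd (cavg L U) φ y κ j‖) (fun _ _ => norm_nonneg _) (Finset.mem_univ κ)
    linarith
  have h0 : 0 ≤ ∑ j : Fin d, ‖covFd (cavg L U) φ y κ j‖ := Finset.sum_nonneg fun _ _ => norm_nonneg _
  nlinarith

include hL hU ha h512 hUa in
/-- **THE LIFT DEFECT, POINTWISE**: `‖(pushDir L U ∘ S₀ − Id) φ (y,κ)‖ ≤ Σ_j ‖covFd (cavg L U) φ y κ j‖ + kPush(d,L)·a·s` for every local
sup `s` of `φ` around `c = (y, κ)`. [folklore] -/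
theorem norm_liftDefect_le (φ : Site d → Fin d → Matrix n n ℂ) (y : Site d) (κ : Fin d) {s : ℝ}
    (hs : ∀ (x : Site d) (μ : Fin d), l1 (x - (L : ℤ) • y) ≤ nbRad d L → ‖φ (cdiv L x) μ‖ ≤ s) :
    ‖liftDefect L U φ y κ‖ ≤ ∑ j : Fin d, ‖covFd (cavg L U) φ y κ j‖ + kPush d L * a * s := by
  have hUc : ∀ z μ, cavg L U z μ ∈ unitaryUnits (Matrix n n ℂ) := fun z μ => cavg_mem hL hU ha h512 hUa z μ
  have h1 := norm_liftDefect_sub_main_le hL hU ha h512 hUa φ y κ hs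
  have h2 := norm_liftMain_le hL hUc φ y κ
  have h3 : ‖liftDefect L U φ y κ‖ ≤ ‖liftMain L U φ y κ‖ + ‖liftDefect L U φ y κ - liftMain L U φ y κ‖ := by
    have := norm_add_le (liftMain L U φ y κ) (liftDefect L U φ y κ - liftMain L U φ y κ)
    rwa [add_sub_cancel] at this
  linarith

end Small

end

end Summit.QuantumFields.BalabanUV.T4Continuum.AveragingDeficitBlockDensityPush
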